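import Summits.QuantumFields.BalabanUV.Beta.EriceRemainderEnclosureHistoryAutonomyComparisonAgeCompositionThreeAgesFlowReads

/-!
# EriceRemainderEnclosureHistoryAutonomyComparisonAgeCompositionThreeAgesRiccati — (E89a) route (N), first order: the ALONG-FLOW LOAD CALCULUS of a
# dominated flow with ANY profile — the inverse cube of a level is a super-solution of the domination read (convexity of `x ↦ x^{3∕2}`), hence (i) every age's
# load decays AT LEAST HYPERBOLICALLY (the Riccati majorant `X_{t+n} ≤ X_t ∕ (1 + X_t·Σ_{i<n} ρ_i)` from the reads at the scales in between), (ii) the young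
# decay across a window (the credit of the B-budget of (E88c)) is AT LEAST `log(1 + (3∕2)h_b³·Σ reads)` — INTEGRATED DOMINATION, tight on saturated flows —,
# and (iii) the defect weight `1 − r·gU₁` of (E88a) is the explicit `((1 − r) + F♭₁)∕(1 + F♭₁)`, monotone in `F♭₁`, with `1 − r ≥ (3∕2)·t·y` (`t` the level
# ratio, `y` the step at `m+k₃`)

Cell `pub-balaban`, β-function sub-cell, BINDER row D4 «RemainderConst leaves for Bałaban's split» (`HOME/BINDER-OWNERS.md`; owner lineage `b2b-balaban-beta-an4`;
this file by co-owner #2 lineage `b2b-balaban-beta-d4-p2`, generation 80), β-FLOW TEAM duty (1), FREEZE (0) honoured (def-free; imports (E88d); uses (E79)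
`strictAnti_of_memFlow` and `seqBox_shift` BY NAME; nothing restated).

HONEST FRAMING (page 1, verbatim and binding).  *"Discharging BetaPertH makes Bałaban's UV stability UNCONDITIONAL — a real constructive-QFT result; it is
NOT the continuum limit and NOT the Clay problem."*  THIS FILE DISCHARGES NOTHING OF THE KIND.  Elementary real analysis about ABSTRACT functionals on a box
]0,γ]^ℕ with displayed floors and profiles — hypotheses of a census, not facts; the form, signs, ages and moments of Bałaban's (1.22) limit functional are NOT
PRINTED ([I] p. 298; GAPS G-t4-U2-1∕-2) and NOT asserted.  Row D4 class UNCHANGED (critical-path width 0; instance 0∕1; D4 DISCHARGE NO DATE).  HONEST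
DEPENDENCY: continuum YM on T⁴ ⇐ BetaPertH ∧ nine spine estimates (0/9 proved); BetaPertH ⇐ (D1) ∧ (D4) ∧ CAP+tail; G-an2-4 gates asym, D1 and NE2/3/4.

THE POINT (census sense (α); route (N); README `HOME/b2b-balaban-beta-d4-p2/g80/e89/README.md` §2–§3).  The λ-budget of (E88c)∕(E88e) is a sum of window sums
of level log-steps (credits), loads (debits), the letter `log(k₃(1 − r·gU₁))` and young floor rows.  Along a flow `1∕h(m+1)² = 1∕h(m)² + B(h(m+1+·))` whose
memory dominates the profile, `B(u) ≥ Σ_{j<K} L_j u_j`, the level `a = 1∕h²` obeys `a_{t+1}^{3∕2} − a_t^{3∕2} ≥ (3∕2)a_t^{1∕2}(a_{t+1} − a_t) ≥ (3∕2)·(Σ_j L_j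
h_{t+1+j})∕h_t` (§1 **`inv_cube_step_ge_read`**).  Consequences, each TIGHT on saturated flows and each measured on the gen-79 census to cost nothing in the light
corner (README §2: the budget with every letter replaced by these bounds keeps the margin `0.241∕0.218∕0.205∕0.199` at `k₃ = 32∕64∕128∕256` against the exact
`0.255∕0.226∕0.210∕0.202`): §2 the load of age `s`, `X_t = L_s h_{t+s}³∕2`, has `1∕X_{t+1} − 1∕X_t ≥ 3·(Σ_j L_j h_{t+s+1+j})∕(L_s h_{t+s}) ≥ 3·h_{t+2s+1}∕h_{t+s}`
(**`inv_load_step`**, **`inv_load_step_own`**) and therefore the HYPERBOLIC MAJORANT **`load_le_hyperbolic`** ∕ **`_own`** from any earlier scale (the pure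
sequence fact is **`le_hyperbolic_of_inv_steps`**) — the debits of a row of the budget are functions of the loads AT THE ROW START; §3 the young decay across
`n` scales from `b` is at least the integrated reads, **`cube_ratio_ge_one_add_reads`** `(h_b∕h_{b+n})³ ≥ 1 + (3∕2)h_b³·Σ_{s<n}(Σ_j L_j h_{b+s+1+j})∕h_{b+s}`,
in logarithms **`three_log_ratio_ge_log_reads`**, and in the three loaded ages' letters **`cube_ratio_ge_three_reads`**; §4 the defect weight:
**`one_sub_cube_ge`** (`1 − t³ ≥ (3∕2)t(1 − t²)`; NOTE `1 − t³ ≤ (3∕2)y − (3∕8)y²` is an UPPER bound — the direction displayed in README g79/e88 §4(1)(iii) is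
corrected here), **`defect_weight_eq`**, **`defect_weight_mono`**, **`defect_weight_ge_step`** (for any positive history: `k₃(1 − r∕(1+u)) ≥ k₃·((3∕2)·t·y + u)∕(1+u)`
for every `u ≥ 0`, `t = h_{n+1}∕h_n`, `y = 1 − t²`).  NOT CLAIMED: the budget along flows (successor: the closure between row-start loads and credit-window
reads, README §3–§4); anything nonlinear; anything printed — NOT B12 Thm 2, NOT BetaPertH.

WHAT IS PROVED ([folklore]; 0 `def`, 0 sorry).  §1 `cube_sub_cube_ge`, `inv_cube_step_ge_read`; §2 `inv_load_step`, `inv_load_step_own`,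
`le_hyperbolic_of_inv_steps`, `load_le_hyperbolic`, `load_le_hyperbolic_own`; §3 `inv_cube_rise_ge_reads`, `cube_ratio_ge_one_add_reads`,
`three_log_ratio_ge_log_reads`, `cube_ratio_ge_three_reads`; §4 `one_sub_cube_ge`, `defect_weight_eq`, `defect_weight_mono`, `defect_weight_ge_step`.
-/
noncomputable section
open Finset

namespace Summit.QuantumFields.BalabanUV.Beta.EriceRemainderEnclosureHistoryAutonomyComparisonAgeCompositionThreeAgesRiccati

open Literature.MathematicalPhysics.QuantumFieldTheory.Balaban1983to89
open Literature.MathematicalPhysics.QuantumFieldTheory.Balaban1983to89.T4BetaStationary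
open Literature.MathematicalPhysics.QuantumFieldTheory.Balaban1983to89.T4BetaFlowWellPosed
open Summit.QuantumFields.BalabanUV.Beta.EriceRemainderEnclosureHistoryAutonomyOrder (strictAnti_of_memFlow)

variable {B : (ℕ → ℝ) → ℝ} {γ b gIR : ℝ} {L : ℕ → ℝ} {K : ℕ} {h : ℕ → ℝ}

/-! ## §1 Convexity of the cube and the inverse-cube step along a dominated flow -/

/-- Convexity of `x ↦ x^{3∕2}` in the variables `u = x^{1∕2}`, `v`: `(3∕2)·u·(v² − u²) ≤ v³ − u³` for `u, v ≥ 0` (the difference is `(v − u)²(v + u∕2)`).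
[folklore] -/
theorem cube_sub_cube_ge {u v : ℝ} (hu : 0 ≤ u) (hv : 0 ≤ v) : 3 / 2 * u * (v ^ 2 - u ^ 2) ≤ v ^ 3 - u ^ 3 := by
  nlinarith [mul_nonneg (sq_nonneg (v - u)) (by linarith : 0 ≤ v + u / 2)]

/-- **THE INVERSE CUBE IS A SUPER-SOLUTION OF THE READ.**  Along a box solution of a memory dominating the profile `L`:
`(3∕2)·(Σ_{j<K} L_jh_{t+1+j})∕h_t ≤ 1∕h_{t+1}³ − 1∕h_t³` (convexity of the cube at `1∕h_t`, then the level step `1∕h_{t+1}² − 1∕h_t² = B(h(t+1+·)) ≥` the read).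
[folklore] -/
theorem inv_cube_step_ge_read (hdom : ∀ u, SeqBox γ u → ∑ k ∈ range K, L k * u k ≤ B u) (hh : SeqBox γ h) (hf : MemFlow B gIR h) (t : ℕ) :
    3 / 2 * (∑ j ∈ range K, L j * h (t + 1 + j)) / h t ≤ 1 / h (t + 1) ^ 3 - 1 / h t ^ 3 := by
  have hpos : ∀ n, 0 < h n := fun n => (hh n).1
  have h0 := hpos t; have h1 := hpos (t + 1)
  have e1 := hf.2 t
  have hdomB : ∑ j ∈ range K, L j * h (t + 1 + j) ≤ B (fun j => h (t + 1 + j)) := hdom _ (seqBox_shift hh (t + 1))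
  have hc := cube_sub_cube_ge (u := 1 / h t) (v := 1 / h (t + 1)) (by positivity) (by positivity)
  rw [one_div_pow, one_div_pow, one_div_pow, one_div_pow] at hc
  have e2 : 1 / h (t + 1) ^ 2 - 1 / h t ^ 2 = B (fun j => h (t + 1 + j)) := by linarith
  rw [e2] at hc
  calc 3 / 2 * (∑ j ∈ range K, L j * h (t + 1 + j)) / h t
      = 3 / 2 * (1 / h t) * ∑ j ∈ range K, L j * h (t + 1 + j) := by ring
    _ ≤ 3 / 2 * (1 / h t) * B (fun j => h (t + 1 + j)) := mul_le_mul_of_nonneg_left hdomB (by positivity)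
    _ ≤ 1 / h (t + 1) ^ 3 - 1 / h t ^ 3 := hc

/-! ## §2 The loads decay at least hyperbolically -/

/-- **THE INVERSE LOAD OF AGE `s` GROWS BY AT LEAST THE READ**: with `X_n = L_sh_{n+s}³∕2` (`L_s > 0`),
`3·(Σ_{j<K} L_jh_{t+s+1+j})∕(L_s·h_{t+s}) ≤ 1∕X_{t+1} − 1∕X_t`.  On a saturated single-age flow the left side is `≈ 3`. [folklore] -/
theorem inv_load_step (hdom : ∀ u, SeqBox γ u → ∑ k ∈ range K, L k * u k ≤ B u) (hh : SeqBox γ h) (hf : MemFlow B gIR h)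
    {s : ℕ} (hLs : 0 < L s) {X : ℕ → ℝ} (hX : ∀ n, X n = L s * h (n + s) ^ 3 / 2) (t : ℕ) :
    3 * (∑ j ∈ range K, L j * h (t + s + 1 + j)) / (L s * h (t + s)) ≤ 1 / X (t + 1) - 1 / X t := by
  have hpos : ∀ n, 0 < h n := fun n => (hh n).1
  have h0 := hpos (t + s); have h1 := hpos (t + 1 + s)
  have hstep := inv_cube_step_ge_read hdom hh hf (t + s)
  rw [show t + s + 1 = t + 1 + s by ring] at hstep ⊢
  have e : 1 / X (t + 1) - 1 / X t = 2 / L s * (1 / h (t + 1 + s) ^ 3 - 1 / h (t + s) ^ 3) := by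
    rw [hX, hX]; field_simp
  have e2 : 3 * (∑ j ∈ range K, L j * h (t + 1 + s + j)) / (L s * h (t + s)) = 2 / L s * (3 / 2 * (∑ j ∈ range K, L j * h (t + 1 + s + j)) / h (t + s)) := by
    field_simp
  rw [e, e2]
  exact mul_le_mul_of_nonneg_left hstep (le_of_lt (div_pos two_pos hLs))

/-- The same keeping only the age's OWN read (`L ≥ 0`, `s < K`): `3·h_{t+2s+1}∕h_{t+s} ≤ 1∕X_{t+1} − 1∕X_t` — the increment of the Riccati majorant.
[folklore] -/
theorem inv_load_step_own (hL : ∀ k, 0 ≤ L k) (hdom : ∀ u, SeqBox γ u → ∑ k ∈ range K, L k * u k ≤ B u) (hh : SeqBox γ h) (hf : MemFlow B gIR h)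
    {s : ℕ} (hsK : s < K) (hLs : 0 < L s) {X : ℕ → ℝ} (hX : ∀ n, X n = L s * h (n + s) ^ 3 / 2) (t : ℕ) :
    3 * h (t + s + 1 + s) / h (t + s) ≤ 1 / X (t + 1) - 1 / X t := by
  have hpos : ∀ n, 0 < h n := fun n => (hh n).1
  have h0 := hpos (t + s)
  have hone : L s * h (t + s + 1 + s) ≤ ∑ j ∈ range K, L j * h (t + s + 1 + j) :=
    single_le_sum (f := fun j => L j * h (t + s + 1 + j)) (fun j _ => mul_nonneg (hL j) (hpos _).le) (mem_range.mpr hsK)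
  have e : 3 * h (t + s + 1 + s) / h (t + s) = 3 * (L s * h (t + s + 1 + s)) / (L s * h (t + s)) := by field_simp
  rw [e]
  exact (div_le_div_of_nonneg_right (by linarith) (by positivity)).trans (inv_load_step hdom hh hf hLs hX t)

/-- **THE RICCATI MAJORANT** (pure sequence fact): if `x > 0` and `1∕x_{i+1} − 1∕x_i ≥ ρ_i ≥ 0` for `i < n`, then `x_n ≤ x_0∕(1 + x_0·Σ_{i<n} ρ_i)`. [folklore] -/
theorem le_hyperbolic_of_inv_steps {x ρ : ℕ → ℝ} (hx : ∀ i, 0 < x i) (hρ : ∀ i, 0 ≤ ρ i) :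
    ∀ n, (∀ i, i < n → ρ i ≤ 1 / x (i + 1) - 1 / x i) → x n ≤ x 0 / (1 + x 0 * ∑ i ∈ range n, ρ i) := by
  intro n hstep
  have hsum : ∀ n, (∀ i, i < n → ρ i ≤ 1 / x (i + 1) - 1 / x i) → 1 / x 0 + ∑ i ∈ range n, ρ i ≤ 1 / x n := by
    intro n
    induction n with
    | zero => intro _; simp
    | succ n ih =>
      intro hs
      rw [sum_range_succ]
      have := hs n (by omega)
      have := ih (fun i hi => hs i (by omega))
      linarith
  have hS := hsum n hstep
  have hpos0 := hx 0; have hposn := hx n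
  have hσ : 0 ≤ ∑ i ∈ range n, ρ i := sum_nonneg fun i _ => hρ i
  have hD : 0 < 1 / x 0 + ∑ i ∈ range n, ρ i := by positivity
  rw [show x 0 / (1 + x 0 * ∑ i ∈ range n, ρ i) = 1 / (1 / x 0 + ∑ i ∈ range n, ρ i) by field_simp, le_div_iff₀ hD]
  calc x n * (1 / x 0 + ∑ i ∈ range n, ρ i) ≤ x n * (1 / x n) := mul_le_mul_of_nonneg_left hS hposn.le
    _ = 1 := by field_simp

/-- **EVERY AGE'S LOAD DECAYS AT LEAST HYPERBOLICALLY FROM ANY EARLIER SCALE** (full reads): with `X_n = L_sh_{n+s}³∕2`, `L_s > 0`, and the read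
increments `ρ_i = 3·(Σ_j L_jh_{t+i+s+1+j})∕(L_s·h_{t+i+s})`: `X_{t+n} ≤ X_t∕(1 + X_t·Σ_{i<n} ρ_i)`. [folklore] -/
theorem load_le_hyperbolic (hL : ∀ k, 0 ≤ L k) (hdom : ∀ u, SeqBox γ u → ∑ k ∈ range K, L k * u k ≤ B u) (hh : SeqBox γ h) (hf : MemFlow B gIR h)
    {s : ℕ} (hLs : 0 < L s) {X : ℕ → ℝ} (hX : ∀ n, X n = L s * h (n + s) ^ 3 / 2) (t n : ℕ) :
    X (t + n) ≤ X t / (1 + X t * ∑ i ∈ range n, 3 * (∑ j ∈ range K, L j * h (t + i + s + 1 + j)) / (L s * h (t + i + s))) := by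
  have hpos : ∀ n, 0 < h n := fun n => (hh n).1
  have hXpos : ∀ n, 0 < X n := fun n => by rw [hX]; have := hpos (n + s); positivity
  have key := le_hyperbolic_of_inv_steps (x := fun i => X (t + i)) (ρ := fun i => 3 * (∑ j ∈ range K, L j * h (t + i + s + 1 + j)) / (L s * h (t + i + s)))
    (fun i => hXpos _) (fun i => by
      have := hpos (t + i + s)
      exact div_nonneg (mul_nonneg (by norm_num) (sum_nonneg fun j _ => mul_nonneg (hL j) (hpos _).le)) (by positivity)) n
    (fun i _ => by
      have := inv_load_step hdom hh hf hLs hX (t + i)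
      rwa [show t + i + 1 = t + (i + 1) by ring] at this)
  simpa using key

/-- The same with the own-read increments `ρ_i = 3·h_{t+i+2s+1}∕h_{t+i+s}` (every other age's read dropped). [folklore] -/
theorem load_le_hyperbolic_own (hL : ∀ k, 0 ≤ L k) (hdom : ∀ u, SeqBox γ u → ∑ k ∈ range K, L k * u k ≤ B u) (hh : SeqBox γ h) (hf : MemFlow B gIR h)
    {s : ℕ} (hsK : s < K) (hLs : 0 < L s) {X : ℕ → ℝ} (hX : ∀ n, X n = L s * h (n + s) ^ 3 / 2) (t n : ℕ) :
    X (t + n) ≤ X t / (1 + X t * ∑ i ∈ range n, 3 * h (t + i + s + 1 + s) / h (t + i + s)) := by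
  have hpos : ∀ n, 0 < h n := fun n => (hh n).1
  have hXpos : ∀ n, 0 < X n := fun n => by rw [hX]; have := hpos (n + s); positivity
  have key := le_hyperbolic_of_inv_steps (x := fun i => X (t + i)) (ρ := fun i => 3 * h (t + i + s + 1 + s) / h (t + i + s))
    (fun i => hXpos _) (fun i => by have := hpos (t + i + s); have := hpos (t + i + s + 1 + s); positivity) n
    (fun i _ => by
      have := inv_load_step_own hL hdom hh hf hsK hLs hX (t + i)
      rwa [show t + i + 1 = t + (i + 1) by ring] at this)
  simpa using key

/-! ## §3 The young decay across a window is at least the integrated reads -/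

/-- Summing §1 across `n` scales from `b`: `(3∕2)·Σ_{s<n}(Σ_j L_jh_{b+s+1+j})∕h_{b+s} ≤ 1∕h_{b+n}³ − 1∕h_b³`. [folklore] -/
theorem inv_cube_rise_ge_reads (hdom : ∀ u, SeqBox γ u → ∑ k ∈ range K, L k * u k ≤ B u) (hh : SeqBox γ h) (hf : MemFlow B gIR h) (b n : ℕ) :
    3 / 2 * ∑ s ∈ range n, (∑ j ∈ range K, L j * h (b + s + 1 + j)) / h (b + s) ≤ 1 / h (b + n) ^ 3 - 1 / h b ^ 3 := by
  rw [mul_sum]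
  calc ∑ s ∈ range n, 3 / 2 * ((∑ j ∈ range K, L j * h (b + s + 1 + j)) / h (b + s))
      ≤ ∑ s ∈ range n, (1 / h (b + (s + 1)) ^ 3 - 1 / h (b + s) ^ 3) := sum_le_sum fun s _ => by
        rw [show b + (s + 1) = b + s + 1 by ring, ← mul_div_assoc]; exact inv_cube_step_ge_read hdom hh hf (b + s)
    _ = 1 / h (b + n) ^ 3 - 1 / h b ^ 3 := by rw [sum_range_sub (fun s => 1 / h (b + s) ^ 3)]; simp

/-- **INTEGRATED DOMINATION**: `1 + (3∕2)·h_b³·Σ_{s<n}(Σ_j L_jh_{b+s+1+j})∕h_{b+s} ≤ (h_b∕h_{b+n})³` — the young decay `(a_{b+n}∕a_b)^{3∕2}` across the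
window is at least one plus the reads integrated against `h_b³`; EQUALITY to leading order on a saturated flow. [folklore] -/
theorem cube_ratio_ge_one_add_reads (hdom : ∀ u, SeqBox γ u → ∑ k ∈ range K, L k * u k ≤ B u) (hh : SeqBox γ h) (hf : MemFlow B gIR h) (b n : ℕ) :
    1 + 3 / 2 * h b ^ 3 * ∑ s ∈ range n, (∑ j ∈ range K, L j * h (b + s + 1 + j)) / h (b + s) ≤ (h b / h (b + n)) ^ 3 := by
  have hpos : ∀ n, 0 < h n := fun n => (hh n).1
  have h0 := hpos b; have h1 := hpos (b + n)
  have hr := inv_cube_rise_ge_reads hdom hh hf b n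
  have := mul_le_mul_of_nonneg_left hr (le_of_lt (pow_pos h0 3))
  have e : h b ^ 3 * (1 / h (b + n) ^ 3 - 1 / h b ^ 3) = (h b / h (b + n)) ^ 3 - 1 := by rw [div_pow]; field_simp
  rw [e] at this
  linarith

/-- The same in logarithms (the credit of the B-budget is `(3∕2)·log(a_{b+n}∕a_b) = 3·log(h_b∕h_{b+n})`):
`log(1 + (3∕2)h_b³·Σ reads) ≤ 3·log(h_b∕h_{b+n})` (`L ≥ 0`). [folklore] -/
theorem three_log_ratio_ge_log_reads (hL : ∀ k, 0 ≤ L k) (hdom : ∀ u, SeqBox γ u → ∑ k ∈ range K, L k * u k ≤ B u) (hh : SeqBox γ h)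
    (hf : MemFlow B gIR h) (b n : ℕ) :
    Real.log (1 + 3 / 2 * h b ^ 3 * ∑ s ∈ range n, (∑ j ∈ range K, L j * h (b + s + 1 + j)) / h (b + s)) ≤ 3 * Real.log (h b / h (b + n)) := by
  have hpos : ∀ n, 0 < h n := fun n => (hh n).1
  have hS : 0 ≤ ∑ s ∈ range n, (∑ j ∈ range K, L j * h (b + s + 1 + j)) / h (b + s) :=
    sum_nonneg fun s _ => div_nonneg (sum_nonneg fun j _ => mul_nonneg (hL j) (hpos _).le) (hpos _).le
  have h0 := hpos b
  have h1 := Real.log_le_log (by positivity) (cube_ratio_ge_one_add_reads hdom hh hf b n)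
  rwa [Real.log_pow, Nat.cast_ofNat] at h1

/-- **INTEGRATED DOMINATION IN THE THREE LOADED AGES' LETTERS** (`1 < k₂ < k₃ < K`, every other age dropped, `L ≥ 0`): with the anchored loads
`d' = L_1h_b³∕2`, `q' = L_{k₂}h_b³∕2`, `c' = L_{k₃}h_b³∕2` (the young, middle and old loads that read the level `h_b`),
`1 + 3·Σ_{s<n}(d'·h_{b+s+2}∕h_{b+s} + q'·h_{b+s+1+k₂}∕h_{b+s} + c'·h_{b+s+1+k₃}∕h_{b+s}) ≤ (h_b∕h_{b+n})³`. [folklore] -/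
theorem cube_ratio_ge_three_reads (hL : ∀ k, 0 ≤ L k) (hdom : ∀ u, SeqBox γ u → ∑ k ∈ range K, L k * u k ≤ B u) (hh : SeqBox γ h)
    (hf : MemFlow B gIR h) {k₂ k₃ : ℕ} (hk2 : 2 ≤ k₂) (hk23 : k₂ < k₃) (hk3K : k₃ < K) (b n : ℕ) :
    1 + 3 * ∑ s ∈ range n, (L 1 * h b ^ 3 / 2 * (h (b + s + 2) / h (b + s)) + L k₂ * h b ^ 3 / 2 * (h (b + s + 1 + k₂) / h (b + s))
      + L k₃ * h b ^ 3 / 2 * (h (b + s + 1 + k₃) / h (b + s))) ≤ (h b / h (b + n)) ^ 3 := by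
  have hpos : ∀ n, 0 < h n := fun n => (hh n).1
  have hsub : ({1, k₂, k₃} : Finset ℕ) ⊆ range K := by
    intro j hj
    simp only [mem_insert, mem_singleton] at hj
    rw [mem_range]; rcases hj with rfl | rfl | rfl <;> omega
  have hthree : ∀ s, L 1 * h (b + s + 1 + 1) + (L k₂ * h (b + s + 1 + k₂) + L k₃ * h (b + s + 1 + k₃)) ≤ ∑ j ∈ range K, L j * h (b + s + 1 + j) := by
    intro s
    have := sum_le_sum_of_subset_of_nonneg hsub (f := fun j => L j * h (b + s + 1 + j)) (fun j _ _ => mul_nonneg (hL j) (hpos _).le)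
    rwa [sum_insert (by simp only [mem_insert, mem_singleton]; omega), sum_pair (by omega)] at this
  have hle : 3 * ∑ s ∈ range n, (L 1 * h b ^ 3 / 2 * (h (b + s + 2) / h (b + s)) + L k₂ * h b ^ 3 / 2 * (h (b + s + 1 + k₂) / h (b + s))
      + L k₃ * h b ^ 3 / 2 * (h (b + s + 1 + k₃) / h (b + s))) ≤ 3 / 2 * h b ^ 3 * ∑ s ∈ range n, (∑ j ∈ range K, L j * h (b + s + 1 + j)) / h (b + s) := by
    rw [mul_sum, mul_sum]
    refine sum_le_sum fun s _ => ?_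
    have hs := hpos (b + s); have hb3 : 0 ≤ h b ^ 3 := le_of_lt (pow_pos (hpos b) 3)
    have e : 3 * (L 1 * h b ^ 3 / 2 * (h (b + s + 2) / h (b + s)) + L k₂ * h b ^ 3 / 2 * (h (b + s + 1 + k₂) / h (b + s))
        + L k₃ * h b ^ 3 / 2 * (h (b + s + 1 + k₃) / h (b + s)))
        = 3 / 2 * h b ^ 3 * ((L 1 * h (b + s + 1 + 1) + (L k₂ * h (b + s + 1 + k₂) + L k₃ * h (b + s + 1 + k₃))) / h (b + s)) := by
      rw [show b + s + 1 + 1 = b + s + 2 by ring]; field_simp; ring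
    rw [e]
    exact mul_le_mul_of_nonneg_left (div_le_div_of_nonneg_right (hthree s) hs.le) (by positivity)
  linarith [cube_ratio_ge_one_add_reads hdom hh hf b n]

/-! ## §4 The defect weight -/

/-- `(3∕2)·t·(1 − t²) ≤ 1 − t³` for `0 ≤ t` (the difference is `(1 − t)²(1 + t∕2)`; used for level ratios `t ≤ 1`): with `y = 1 − t²` the defect `1 − r`, `r = t³`, is at least
`(3∕2)·t·y = (3∕2)·y·√(1−y)`.  NOTE the popular `(3∕2)y − (3∕8)y²` is an UPPER bound of `1 − t³`, not a lower one. [folklore] -/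
theorem one_sub_cube_ge {t : ℝ} (h0 : 0 ≤ t) : 3 / 2 * t * (1 - t ^ 2) ≤ 1 - t ^ 3 := by
  nlinarith [mul_nonneg (sq_nonneg (1 - t)) (by linarith : 0 ≤ 1 + t / 2)]

/-- The defect weight with the envelope `gU₁ = 1∕(1+u)`: `1 − r∕(1+u) = ((1 − r) + u)∕(1 + u)`. [folklore] -/
theorem defect_weight_eq (r : ℝ) {u : ℝ} (hu : 0 ≤ u) : 1 - r * (1 / (1 + u)) = ((1 - r) + u) / (1 + u) := by
  have : (1 + u) ≠ 0 := by linarith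
  field_simp
  ring

/-- … is non-decreasing in `u ≥ 0` when `r ≥ 0` (so LOWER bounds on the floor-damped load may be inserted). [folklore] -/
theorem defect_weight_mono {r u₁ u₂ : ℝ} (hr : 0 ≤ r) (hu₁ : 0 ≤ u₁) (h12 : u₁ ≤ u₂) :
    ((1 - r) + u₁) / (1 + u₁) ≤ ((1 - r) + u₂) / (1 + u₂) := by
  rw [div_le_div_iff₀ (by linarith) (by linarith)]
  nlinarith

/-- **THE DEFECT WEIGHT ALONG THE FLOW**: for any box-valued history (only `h > 0` is used), at every scale `n` and for every `u ≥ 0`, with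
`t = h_{n+1}∕h_n` and the step `y = 1 − t²`: `((3∕2)·t·y + u)∕(1 + u) ≤ 1 − t³·(1∕(1 + u))` — the letter `Z = k₃(1 − r·gU₁)` of the B-budget
is at least `k₃·((3∕2)t·y_{m+k₃} + F♭₁)∕(1 + F♭₁)`, and `y_{m+k₃}` dominates the three reads one pin deeper ((E88d) `step_ge_reads_three`). [folklore] -/
theorem defect_weight_ge_step (hh : SeqBox γ h) (n : ℕ) {u : ℝ} (hu : 0 ≤ u) :
    (3 / 2 * (h (n + 1) / h n) * (1 - (h (n + 1) / h n) ^ 2) + u) / (1 + u) ≤ 1 - (h (n + 1) / h n) ^ 3 * (1 / (1 + u)) := by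
  have hpos : ∀ n, 0 < h n := fun n => (hh n).1
  have ht0 : 0 ≤ h (n + 1) / h n := le_of_lt (div_pos (hpos _) (hpos _))
  rw [defect_weight_eq _ hu]
  exact div_le_div_of_nonneg_right (by linarith [one_sub_cube_ge ht0]) (by linarith)

end Summit.QuantumFields.BalabanUV.Beta.EriceRemainderEnclosureHistoryAutonomyComparisonAgeCompositionThreeAgesRiccati

end
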